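import Summits.RiemannHypothesis.RiemannHypothesis.Theorems.TiltedLandingLaw421R3Lens1ArcSignK

/-!
# TiltedLandingLaw421R3 — lens-1 (part L): GAP ORDER (consecutive pieces only) ⇒ the atomic NET law

LENS-1 gen-7 module image `rh33346-cover/lens-1/AtomicGapOrder-v1.lean` (landing target `…/Theorems/TiltedLandingLaw421R3Lens1ArcSignL.lean`; ONE import = part K
`…R3Lens1ArcSignK` = image `lens-1/AtomicLens-v1.lean` dcb386b07eff4002 until it is tree; namespace `RhW08.Lens1ArcSign`; 0 `sorry`; checked BY CHAIN
`lens-1/AtomicGapOrder-v1-chain.lean` over the tree parts A–I + `…R3NestedSign`).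

WHY THIS FILE.  C6ʼs mechanism for ORDER (g37 §2.6: walk the boundary of the negative tongue from the end of one bad piece to the start of the NEXT one;
`Re φ` increases along the sealing nodal arc by Cauchy–Riemann) proves the order relation for CONSECUTIVE pieces only.  Part Kʼs `ArcOrder` asks it for ALL
pairs (what the census verified), which is more than the mechanism gives.  Here the typed law is weakened to exactly the mechanismʼs output — ★ `ArcGapOrder`
(«hi_i ≤ lo_{i+1}»: pieces with no bad point between them) — and the payment is re-proved at that level: consecutive order no longer forces `#asc ≤ 1`
(asc, desc, asc is allowed) but it DOES force the NET count `#asc ≤ #desc + 1`, which is what part Jʼs split consumes (`topPinningResidual_of_netSplit`).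

CONTENT. §1 `ArcGapOrder`, `arcGapOrder_of_arcOrder`, ★ `AtomicGapOrderLawQ` (OPEN; ⟸ `AtomicOrderLawQ`) · §2 piece combinatorics at a fixed radius:
`badPiece_end_unique`, `badPiece_le_of_lt`, ★ `exists_badPiece_around` (with finitely many real points, a positive point between two real points lies in a
bad piece between them), ★★ `exists_desc_between` (FIRST-DROP LEMMA: under gap order, strictly between two ascending pieces there is a descending one —
the gap steps `hi_k → lo_{k+1}` never decrease, so the sign of `Re φ` can fall from `+` to `−` only INSIDE a piece), ★★ `netCount_of_gapOrder` (injection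
`s ↦ first descending start after s` on the ascending starts minus the last ⇒ `#asc ≤ #desc + 1`) · §3 the generic radius: `netLeOne_of_gapOrder` (finitely
many radii carry a zero of `f^{(j)}` or `f^{(j+1)}`; off them part Dʼs `breaks_finite_or_flat` applies) ⇒ ★★ `atomicNetLaw_of_gapOrderLaw :
AtomicGapOrderLawQ → AtomicNetLawQ` ⇒ `topPinningResidual_of_gapOrderSplit : AtomicGapOrderLawQ → NonAtomicTopResidualQ → TopPinningNonNestedAscResidual`.

THE ATOMIC LADDER (all arrows PROVED, all laws OPEN):  `AtomicOrderLawQ ⟹ AtomicGapOrderLawQ ⟹ AtomicNetLawQ ⟹(RUNG 4) law on the atomic class`, and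
`AtomicOrderLawQ ⟹ AtomicShapeLawQ ⟹ AtomicNetLawQ`.  The weakest typed sufficient statement with a named mechanism is `AtomicGapOrderLawQ`.

HONEST LABEL: combinatorics + one reduction; every law named here, `TopPinning`, 33346, 33347 OPEN; nothing here bears on the truth of RH; RH is not proved;
checked ≠ landed ≠ proved.
-/

noncomputable section

namespace RhW08.Lens1ArcSign

open Complex Set Metric Filter Topology
open scoped Real ComplexConjugate
open Literature.Topology.PlaneTopology Literature.Analysis.Complex
open Summit.RiemannHypothesis.RiemannHypothesis.Theorems.Splittings.JensenWindow
open RhIdea6.G17.W07C7 RhIdea6.G17.W07C7.Rev6 RhIdea6.G18.W07C8.Law421BirthS RhIdea6.G19.W07C11.Seam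
open RhIdea6.G20.W07C12.Frac RhIdea6.G20.W07C12.StColP RhW07.C12.FieldSplit RhIdea6.G21.W07C13.TentMax
open RhW07.C14.TwoSided RhW07.C14.Classes RhW07.C14.Lineage RhW07.C14.Booking
open RhW07.C13.Heredity RhIdea6.G22.W07C15pre.Injection RhW07.E3.Cell RhW07.E3.Lit
open RhW08.Round1 RhW08.StSwap RhW08.Round2 RhW08.QuadW RhW08.SealSwapQ RhW08.SealSwap RhW08.SuccB RhW08.SuccSplit
open RhW08.SuccTheft RhW08.Column RhW08.Hurwitz RhW08.ClusterQ RhW08.ClusterQM RhW08.NewtonDoor RhW08.NewtonDoorGenusOne RhW08.PurseP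
open RhW08.Lens1SignCut RhW08.Lens1Coverage RhW08.IsolatedTilt RhW08.Lens1Pinning RhW08.Lens1PinningIso

/-! ## §1 Gap order -/

/-- ★ GAP ORDER at radius excess `δ` (the CONSECUTIVE form of part Kʼs `ArcOrder`; C6 g37 §2.6 «hi_i ≤ lo_{i+1}»): for bad pieces `(t₁,t₂)`, `(t₃,t₄)`
with `t₂ ≤ t₃` and NO bad point between them (`Im φ ≤ 0` on `[t₂, t₃]`), `Re φ(t₂) ≤ Re φ(t₃)`. -/
def ArcGapOrder (f : ℂ → ℂ) (j : ℕ) (a : ℂ) (δ : ℝ) : Prop :=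
  ∀ t₁ t₂ t₃ t₄ : ℝ, BadPiece f j a δ t₁ t₂ → BadPiece f j a δ t₃ t₄ → t₂ ≤ t₃ →
    (∀ t ∈ Icc t₂ t₃, (arcPhi f j a δ t).im ≤ 0) → (arcPhi f j a δ t₂).re ≤ (arcPhi f j a δ t₃).re

/-- All-pairs order implies gap order. -/
theorem arcGapOrder_of_arcOrder {f : ℂ → ℂ} {j : ℕ} {a : ℂ} {δ : ℝ} (h : ArcOrder f j a δ) : ArcGapOrder f j a δ :=
  fun t₁ t₂ t₃ t₄ h₁ h₂ h23 _ => h t₁ t₂ t₃ t₄ h₁ h₂ h23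

/-- ★ THE ATOMIC GAP-ORDER LAW (OPEN; NEEDS NEW INPUT — nodal topology (i)/(ii) of C6 g37 §2.6; census as for ORDER): on a legal frame, a top upper zero
`a` with an atomic mate `v`, both simple, has GAP-ORDERED consecutive pieces on every small Jensen circle outside finitely many radii. -/
def AtomicGapOrderLawQ : Prop :=
  ∀ (η : ℝ) (f : ℂ → ℂ) (x₀ s hmax R Hs : ℝ) (B : ℕ), EngineHyps5 2 η f x₀ s hmax R Hs B → ∀ (j : ℕ) (a v : ℂ),
    iteratedDeriv j f a = 0 → 0 < a.im → NoTallerToucher f j a → Atomic f j a v →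
    iteratedDeriv (j + 1) f a ≠ 0 → iteratedDeriv (j + 1) f v ≠ 0 → ∃ d0 > 0, ∃ E : Set ℝ, E.Finite ∧ ∀ δ ∈ Ioo 0 d0 \ E, ArcGapOrder f j a δ

/-- ORDER ⇒ GAP ORDER at law level. -/
theorem atomicGapOrderLaw_of_orderLaw (h : AtomicOrderLawQ) : AtomicGapOrderLawQ := by
  intro η f x₀ s hmax R Hs B hE j a v ha hapos hN hA hda hdv
  obtain ⟨d0, hd0, E, hEfin, hO⟩ := h η f x₀ s hmax R Hs B hE j a v ha hapos hN hA hda hdv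
  exact ⟨d0, hd0, E, hEfin, fun δ hδ => arcGapOrder_of_arcOrder (hO δ hδ)⟩

/-! ## §2 Piece combinatorics at a fixed radius -/

section Pieces

variable {f : ℂ → ℂ} {j : ℕ} {a : ℂ} {δ : ℝ}

/-- The later end of a bad piece is determined by the earlier one. -/
theorem badPiece_end_unique {t₁ t₂ t₂' : ℝ} (h : BadPiece f j a δ t₁ t₂) (h' : BadPiece f j a δ t₁ t₂') : t₂ = t₂' := by
  by_contra hne
  rcases lt_or_gt_of_ne hne with hlt | hlt
  · have := h'.2.2.2.1 t₂ ⟨h.2.1, hlt⟩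
    linarith [h.2.2.2.2.2]
  · have := h.2.2.2.1 t₂' ⟨h'.2.1, hlt⟩
    linarith [h'.2.2.2.2.2]

/-- Bad pieces do not overlap: a piece starting later starts after the earlier one ends. -/
theorem badPiece_le_of_lt {t₁ t₂ t₃ t₄ : ℝ} (h : BadPiece f j a δ t₁ t₂) (h' : BadPiece f j a δ t₃ t₄) (hlt : t₁ < t₃) : t₂ ≤ t₃ := by
  by_contra hgt
  push Not at hgt
  have := h.2.2.2.1 t₃ ⟨hlt, hgt⟩
  linarith [h'.2.2.2.2.1]

/-- ★ With finitely many real points on `[0, ½]` and `Im φ` continuous there: a point `t` with `Im φ(t) > 0` lying between two real points `r < t < p`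
lies inside a bad piece `(u, w)` with `r ≤ u < t < w ≤ p` (the maximal positivity interval around `t`). -/
theorem exists_badPiece_around (hfin : {t : ℝ | t ∈ Icc (0 : ℝ) (1 / 2) ∧ (arcPhi f j a δ t).im = 0}.Finite)
    (hcont : ContinuousOn (fun t => (arcPhi f j a δ t).im) (Icc 0 (1 / 2))) {r p t : ℝ} (hr0 : 0 ≤ r)
    (hrim : (arcPhi f j a δ r).im = 0) (hp : p ≤ 1 / 2) (hpim : (arcPhi f j a δ p).im = 0) (hrt : r < t) (htp : t < p)
    (ht : 0 < (arcPhi f j a δ t).im) : ∃ u w : ℝ, BadPiece f j a δ u w ∧ r ≤ u ∧ u < t ∧ t < w ∧ w ≤ p := by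
  classical
  set Zl : Set ℝ := {z | (z ∈ Icc (0 : ℝ) (1 / 2) ∧ (arcPhi f j a δ z).im = 0) ∧ z < t} with hZl
  set Zr : Set ℝ := {z | (z ∈ Icc (0 : ℝ) (1 / 2) ∧ (arcPhi f j a δ z).im = 0) ∧ t < z} with hZr
  have hZlfin : Zl.Finite := hfin.subset fun z hz => hz.1
  have hZrfin : Zr.Finite := hfin.subset fun z hz => hz.1
  have hrZ : r ∈ Zl := ⟨⟨⟨hr0, by linarith⟩, hrim⟩, hrt⟩
  have hpZ : p ∈ Zr := ⟨⟨⟨by linarith, hp⟩, hpim⟩, htp⟩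
  have huZ : sSup Zl ∈ Zl := Set.Nonempty.csSup_mem ⟨r, hrZ⟩ hZlfin
  have hwZ : sInf Zr ∈ Zr := Set.Nonempty.csInf_mem ⟨p, hpZ⟩ hZrfin
  have hru : r ≤ sSup Zl := le_csSup hZlfin.bddAbove hrZ
  have hwp : sInf Zr ≤ p := csInf_le hZrfin.bddBelow hpZ
  have hne : ∀ x ∈ Ioo (sSup Zl) (sInf Zr), (arcPhi f j a δ x).im ≠ 0 := by
    intro x hx h0
    have hxI : x ∈ Icc (0 : ℝ) (1 / 2) := ⟨by linarith [huZ.1.1.1, hx.1], by linarith [hwZ.1.1.2, hx.2]⟩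
    rcases lt_trichotomy x t with hlt | heq | hgt
    · have := le_csSup hZlfin.bddAbove (⟨⟨hxI, h0⟩, hlt⟩ : x ∈ Zl)
      linarith [hx.1]
    · rw [heq] at h0
      linarith
    · have := csInf_le hZrfin.bddBelow (⟨⟨hxI, h0⟩, hgt⟩ : x ∈ Zr)
      linarith [hx.2]
  have hsign := pos_or_neg_of_ne_zero (hcont.mono (Icc_subset_Icc huZ.1.1.1 hwZ.1.1.2)) hne
  have hpos : ∀ x ∈ Ioo (sSup Zl) (sInf Zr), 0 < (arcPhi f j a δ x).im := by
    rcases hsign with h | h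
    · exact h
    · have := h t ⟨huZ.2, hwZ.2⟩
      linarith
  exact ⟨sSup Zl, sInf Zr, ⟨huZ.1.1.1, by linarith [huZ.2, hwZ.2], hwZ.1.1.2, hpos, huZ.1.2, hwZ.1.2⟩, hru, huZ.2, hwZ.2, hwp⟩

/-- ★★ FIRST-DROP LEMMA.  Finitely many real points, `Im φ` continuous, `φ ≠ 0` at its real points, GAP ORDER.  Then strictly between two ASCENDING
pieces there is a DESCENDING one. -/
theorem exists_desc_between (hfin : {t : ℝ | t ∈ Icc (0 : ℝ) (1 / 2) ∧ (arcPhi f j a δ t).im = 0}.Finite)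
    (hcont : ContinuousOn (fun t => (arcPhi f j a δ t).im) (Icc 0 (1 / 2)))
    (hre : ∀ t ∈ Icc (0 : ℝ) (1 / 2), (arcPhi f j a δ t).im = 0 → (arcPhi f j a δ t).re ≠ 0) (hO : ArcGapOrder f j a δ)
    {s s' : ℝ} (hs : s ∈ ascStarts f j a δ) (hs' : s' ∈ ascStarts f j a δ) (hss' : s < s') :
    ∃ d ∈ descStarts f j a δ, s < d ∧ d < s' := by
  classical
  obtain ⟨e, hP, hlo, hhi⟩ := hs
  obtain ⟨e', hP', hlo', -⟩ := hs'
  have hes' : e ≤ s' := badPiece_le_of_lt hP hP' hss'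
  -- the EARLIEST piece start in `[e, s']` with negative `Re φ`
  set S : Set ℝ := {p | (∃ q, BadPiece f j a δ p q) ∧ e ≤ p ∧ p ≤ s' ∧ (arcPhi f j a δ p).re < 0} with hSdef
  have hSfin : S.Finite := hfin.subset (by
    rintro p ⟨⟨q, hpq⟩, -, -, -⟩
    exact ⟨⟨hpq.1, by linarith [hpq.2.1, hpq.2.2.1]⟩, hpq.2.2.2.2.1⟩)
  have hs'S : s' ∈ S := ⟨⟨e', hP'⟩, hes', le_rfl, hlo'⟩
  have hp₀S : sInf S ∈ S := Set.Nonempty.csInf_mem ⟨s', hs'S⟩ hSfin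
  have hp₀min : ∀ p ∈ S, sInf S ≤ p := fun p hp => csInf_le hSfin.bddBelow hp
  set p₀ : ℝ := sInf S with hp₀
  obtain ⟨⟨q₀, hP₀⟩, hep₀, hp₀s', hlo₀⟩ := hp₀S
  -- the LATEST piece start in `[s, p₀)`
  set Q : Set ℝ := {p | (∃ q, BadPiece f j a δ p q) ∧ s ≤ p ∧ p < p₀} with hQdef
  have hQfin : Q.Finite := hfin.subset (by
    rintro p ⟨⟨q, hpq⟩, -, -⟩
    exact ⟨⟨hpq.1, by linarith [hpq.2.1, hpq.2.2.1]⟩, hpq.2.2.2.2.1⟩)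
  have hsp₀ : s < p₀ := lt_of_lt_of_le hP.2.1 hep₀
  have hsQ : s ∈ Q := ⟨⟨e, hP⟩, le_rfl, hsp₀⟩
  have hq₁Q : sSup Q ∈ Q := Set.Nonempty.csSup_mem ⟨s, hsQ⟩ hQfin
  have hq₁max : ∀ p ∈ Q, p ≤ sSup Q := fun p hp => le_csSup hQfin.bddAbove hp
  set q₁ : ℝ := sSup Q with hq₁
  obtain ⟨⟨r, hPq⟩, hsq₁, hq₁p₀⟩ := hq₁Q
  have hrp₀ : r ≤ p₀ := badPiece_le_of_lt hPq hP₀ hq₁p₀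
  -- no bad point between `r` and `p₀` (else a piece would start inside `(q₁, p₀)`)
  have hgap : ∀ t ∈ Icc r p₀, (arcPhi f j a δ t).im ≤ 0 := by
    intro t ht
    by_contra hpos
    push Not at hpos
    have hrt : r < t := lt_of_le_of_ne ht.1 (by rintro rfl; linarith [hPq.2.2.2.2.2])
    have htp : t < p₀ := lt_of_le_of_ne ht.2 (by rintro rfl; linarith [hP₀.2.2.2.2.1])
    obtain ⟨u, w, hPuw, hru, hut, -, -⟩ := exists_badPiece_around hfin hcont (by linarith [hPq.1, hPq.2.1]) hPq.2.2.2.2.2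
      (by linarith [hP₀.2.1, hP₀.2.2.1]) hP₀.2.2.2.2.1 hrt htp hpos
    have huQ : u ∈ Q := ⟨⟨w, hPuw⟩, by linarith [hPq.2.1], by linarith⟩
    have := hq₁max u huQ
    linarith [hPq.2.1]
  -- gap order between `(q₁, r)` and `(p₀, q₀)`
  have hord := hO q₁ r p₀ q₀ hPq hP₀ hrp₀ hgap
  -- `q₁ ≠ s` (the piece `(s, e)` ends with positive `Re φ`)
  have hsq₁' : s < q₁ := by
    rcases eq_or_lt_of_le hsq₁ with heq | hlt
    · exfalso
      have hPs : BadPiece f j a δ s r := by rw [heq]; exact hPq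
      have : r = e := badPiece_end_unique hPs hP
      rw [this] at hord
      linarith
    · exact hlt
  have heq₁ : e ≤ q₁ := badPiece_le_of_lt hP hPq hsq₁'
  -- `Re φ(q₁) > 0`: otherwise `q₁ ∈ S`, contradicting the minimality of `p₀`
  have hloq : 0 < (arcPhi f j a δ q₁).re := by
    rcases lt_trichotomy (arcPhi f j a δ q₁).re 0 with hneg | hzero | hpos
    · have hmem : q₁ ∈ S := ⟨⟨r, hPq⟩, heq₁, by linarith, hneg⟩
      linarith [hp₀min q₁ hmem]
    · exact absurd hzero (hre q₁ ⟨hPq.1, by linarith [hPq.2.1, hPq.2.2.1]⟩ hPq.2.2.2.2.1)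
    · exact hpos
  exact ⟨q₁, ⟨r, hPq, hloq, by linarith⟩, hsq₁', by linarith⟩

/-- ★★ THE COUNT.  Finitely many real points, `Im φ` continuous, `φ ≠ 0` at its real points, GAP ORDER ⇒ `#asc ≤ #desc + 1` (the map «`s ↦` first
descending start after `s`» is injective on the ascending starts other than the last). -/
theorem netCount_of_gapOrder (hfin : {t : ℝ | t ∈ Icc (0 : ℝ) (1 / 2) ∧ (arcPhi f j a δ t).im = 0}.Finite)
    (hcont : ContinuousOn (fun t => (arcPhi f j a δ t).im) (Icc 0 (1 / 2)))
    (hre : ∀ t ∈ Icc (0 : ℝ) (1 / 2), (arcPhi f j a δ t).im = 0 → (arcPhi f j a δ t).re ≠ 0) (hO : ArcGapOrder f j a δ) :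
    (ascStarts f j a δ).Finite ∧ (ascStarts f j a δ).ncard ≤ (descStarts f j a δ).ncard + 1 := by
  classical
  have hAfin : (ascStarts f j a δ).Finite := hfin.subset (ascSet_subset (arcPhi f j a δ))
  have hDfin : (descStarts f j a δ).Finite := hfin.subset (descSet_subset (arcPhi f j a δ))
  refine ⟨hAfin, ?_⟩
  by_cases hA0 : ascStarts f j a δ = ∅
  · rw [hA0, Set.ncard_empty]; exact Nat.zero_le _
  have hAne : (ascStarts f j a δ).Nonempty := Set.nonempty_iff_ne_empty.2 hA0
  have hsM : sSup (ascStarts f j a δ) ∈ ascStarts f j a δ := hAne.csSup_mem hAfin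
  have hle : ∀ s ∈ ascStarts f j a δ, s ≤ sSup (ascStarts f j a δ) := fun s hs => le_csSup hAfin.bddAbove hs
  set sM : ℝ := sSup (ascStarts f j a δ) with hsMdef
  set g : ℝ → ℝ := fun s => sInf {d : ℝ | d ∈ descStarts f j a δ ∧ s < d} with hg
  have hgspec : ∀ s ∈ ascStarts f j a δ \ {sM}, g s ∈ descStarts f j a δ ∧ s < g s ∧ ∀ d ∈ descStarts f j a δ, s < d → g s ≤ d := by
    intro s hs
    rw [Set.mem_sdiff_singleton] at hs
    have hslt : s < sM := lt_of_le_of_ne (hle s hs.1) hs.2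
    obtain ⟨d, hd, hsd, -⟩ := exists_desc_between hfin hcont hre hO hs.1 hsM hslt
    have hTne : ({d : ℝ | d ∈ descStarts f j a δ ∧ s < d}).Nonempty := ⟨d, hd, hsd⟩
    have hTfin : ({d : ℝ | d ∈ descStarts f j a δ ∧ s < d}).Finite := hDfin.subset fun x hx => hx.1
    have hmem := hTne.csInf_mem hTfin
    exact ⟨hmem.1, hmem.2, fun d' hd' hsd' => csInf_le hTfin.bddBelow ⟨hd', hsd'⟩⟩
  have hinj : Set.InjOn g (ascStarts f j a δ \ {sM}) := by
    intro s₁ hs₁ s₂ hs₂ heq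
    by_contra hne
    have hs₁A : s₁ ∈ ascStarts f j a δ := (Set.mem_sdiff_singleton.1 hs₁).1
    have hs₂A : s₂ ∈ ascStarts f j a δ := (Set.mem_sdiff_singleton.1 hs₂).1
    rcases lt_or_gt_of_ne hne with hlt | hlt
    · obtain ⟨d, hd, h1d, hd2⟩ := exists_desc_between hfin hcont hre hO hs₁A hs₂A hlt
      have h1 := (hgspec s₁ hs₁).2.2 d hd h1d
      have h2 := (hgspec s₂ hs₂).2.1
      rw [heq] at h1
      linarith
    · obtain ⟨d, hd, h2d, hd1⟩ := exists_desc_between hfin hcont hre hO hs₂A hs₁A hlt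
      have h1 := (hgspec s₂ hs₂).2.2 d hd h2d
      have h2 := (hgspec s₁ hs₁).2.1
      rw [← heq] at h1
      linarith
  have hcard := Set.ncard_le_ncard_of_injOn g (fun s hs => (hgspec s hs).1) hinj hDfin
  have hadd := Set.ncard_sdiff_singleton_add_one hsM hAfin
  omega

end Pieces

/-! ## §3 The generic radius, and the law-level reduction -/

set_option maxHeartbeats 800000 in
/-- ★ GAP ORDER on the small circles (cofinitely) ⇒ `NetLeOne` — the finitely many radii through a zero of `f^{(j)}` or `f^{(j+1)}` are thrown out;
elsewhere part Dʼs `breaks_finite_or_flat` and §2 apply. -/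
theorem netLeOne_of_gapOrder {η : ℝ} {f : ℂ → ℂ} {x₀ s hmax R Hs : ℝ} {B : ℕ} (hE : EngineHyps5 2 η f x₀ s hmax R Hs B) {j : ℕ} {a : ℂ}
    (ha : iteratedDeriv j f a = 0) (hapos : 0 < a.im) (hnz : iteratedDeriv j f ≠ 0)
    (hO : ∃ d0 > 0, ∃ E : Set ℝ, E.Finite ∧ ∀ δ ∈ Ioo 0 d0 \ E, ArcGapOrder f j a δ) : NetLeOne f j a := by
  classical
  have hf : RealEntireLt2 f := realEntireLt2_of_hyps hE
  set G : ℂ → ℂ := iteratedDeriv j f with hGdef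
  have hG : RealEntireLt2 G := RhW08.WindowLoss.realEntireLt2_iteratedDeriv hf j
  have e1 : deriv G = iteratedDeriv (j + 1) f := by rw [hGdef, ← iteratedDeriv_succ]
  have hHs : 0 ≤ Hs := hE.2.2.2.2.2.2.2.1
  have hG'ne : iteratedDeriv (j + 1) f ≠ 0 := iteratedDeriv_succ_ne_zero_of_zero hf.diff j hnz ha
  have hG'd : Differentiable ℂ (iteratedDeriv (j + 1) f) := differentiable_iteratedDeriv_of_entire hf.diff (j + 1)
  obtain ⟨d0, hd0, E, hEfin, hO⟩ := hO
  set L : ℝ := a.im + Hs + 2 with hL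
  have hz₀ : ((a.re : ℂ)) ∈ Ioo (a.re - L) (a.re + L) ×ℂ Ioo (-(Hs + 1)) (Hs + 1) :=
    ofReal_mem_box (by rw [sub_self, abs_zero]; linarith) hHs
  set Z : Set ℂ := {ρ : ℂ | G ρ = 0 ∧ ρ ∈ Ioo (a.re - L) (a.re + L) ×ℂ Ioo (-(Hs + 1)) (Hs + 1)} ∪
    {ρ : ℂ | iteratedDeriv (j + 1) f ρ = 0 ∧ ρ ∈ Ioo (a.re - L) (a.re + L) ×ℂ Ioo (-(Hs + 1)) (Hs + 1)} with hZ
  have hZfin : Z.Finite := (finite_zeros_box hG.diff hnz hz₀).union (finite_zeros_box hG'd hG'ne hz₀)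
  have hbad : ((fun ρ : ℂ => ‖ρ - (a.re : ℂ)‖ - a.im) '' Z ∪ E).Finite := (hZfin.image _).union hEfin
  refine ⟨min d0 1, lt_min hd0 one_pos, _, hbad, fun δ hδ => ?_⟩
  obtain ⟨⟨hδ0, hδ1⟩, hδbad⟩ := hδ
  have hδd0 : δ < d0 := lt_of_lt_of_le hδ1 (min_le_left _ _)
  have hδone : δ < 1 := lt_of_lt_of_le hδ1 (min_le_right _ _)
  have hr : 0 < a.im + δ := by linarith
  have haHs : |a.im| ≤ Hs := abs_im_le_of_level hE hnz ha
  rw [abs_of_pos hapos] at haHs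
  have hbox : ∀ u : ℂ, ‖u - (a.re : ℂ)‖ = a.im + δ → u ∈ Ioo (a.re - L) (a.re + L) ×ℂ Ioo (-(Hs + 1)) (Hs + 1) := by
    intro u hu
    have h1 := abs_re_le_norm (u - (a.re : ℂ))
    have h2 := abs_im_le_norm (u - (a.re : ℂ))
    rw [hu] at h1 h2
    rw [sub_re, ofReal_re, abs_le] at h1
    rw [sub_im, ofReal_im, sub_zero, abs_le] at h2
    exact mem_reProdIm.2 ⟨⟨by linarith [h1.1], by linarith [h1.2]⟩, ⟨by linarith [h2.1], by linarith [h2.2]⟩⟩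
  have hG0 : ∀ u : ℂ, ‖u - ((a.re : ℝ) : ℂ)‖ = a.im + δ → G u ≠ 0 := fun u hu h0 =>
    hδbad (Or.inl ⟨u, Or.inl ⟨h0, hbox u hu⟩, by simp only [hu]; ring⟩)
  have hG'0 : ∀ u : ℂ, ‖u - ((a.re : ℝ) : ℂ)‖ = a.im + δ → iteratedDeriv (j + 1) f u ≠ 0 := fun u hu h0 =>
    hδbad (Or.inl ⟨u, Or.inr ⟨h0, hbox u hu⟩, by simp only [hu]; ring⟩)
  have hδE : δ ∉ E := fun h => hδbad (Or.inr h)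
  have hγ : ∀ t : ℝ, ‖circleLoop (a.re : ℂ) (a.im + δ) t - (a.re : ℂ)‖ = a.im + δ := fun t => by
    rw [norm_circleLoop_sub_center, abs_of_pos hr]
  have hG0t : ∀ t : ℝ, G (circleLoop (a.re : ℂ) (a.im + δ) t) ≠ 0 := fun t => hG0 _ (hγ t)
  have hcont : ContinuousOn (fun t => (arcPhi f j a δ t).im) (Icc 0 (1 / 2)) := fun t _ =>
    (analyticAt_im_logDeriv_circleLoop hG.diff hG0t t).continuousAt.continuousWithinAt
  have hre : ∀ t ∈ Icc (0 : ℝ) (1 / 2), (arcPhi f j a δ t).im = 0 → (arcPhi f j a δ t).re ≠ 0 := by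
    intro t _ him hre0
    have hφ0 : arcPhi f j a δ t = 0 := Complex.ext (by rw [hre0]; rfl) (by rw [him]; rfl)
    have hd : deriv G (circleLoop (a.re : ℂ) (a.im + δ) t) = 0 := by
      rcases div_eq_zero_iff.1 hφ0 with h1 | h2
      · exact h1
      · exact absurd h2 (hG0t t)
    rw [e1] at hd
    exact hG'0 _ (hγ t) hd
  rcases breaks_finite_or_flat hG.diff hG0t with hfin | hflat
  · exact netCount_of_gapOrder hfin hcont hre (hO δ ⟨⟨hδ0, hδd0⟩, hδE⟩)
  · have hA : ascStarts f j a δ = ∅ := by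
      rw [ascStarts_eq_ascSet]
      exact ascSet_eq_empty_of_flat (Γ := arcPhi f j a δ) hflat
    rw [hA]
    exact ⟨Set.finite_empty, by rw [Set.ncard_empty]; exact Nat.zero_le _⟩

/-- ★★ THE REDUCTION: the atomic GAP-ORDER law gives the atomic NET law. -/
theorem atomicNetLaw_of_gapOrderLaw (h : AtomicGapOrderLawQ) : AtomicNetLawQ := by
  intro η f x₀ s hmax R Hs B hE j a v ha hapos hN hA hda hdv
  have hf : RealEntireLt2 f := realEntireLt2_of_hyps hE
  have hnz : iteratedDeriv j f ≠ 0 := by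
    intro h0
    apply hdv
    rw [iteratedDeriv_succ, h0]; simp
  exact netLeOne_of_gapOrder hE ha hapos hnz (h η f x₀ s hmax R Hs B hE j a v ha hapos hN hA hda hdv)

/-- … hence GAP ORDER + the non-atomic residual give part Iʼs residual (via part Jʼs NET split) … -/
theorem topPinningResidual_of_gapOrderSplit (hO : AtomicGapOrderLawQ) (hR : NonAtomicTopResidualQ) : TopPinningNonNestedAscResidual :=
  topPinningResidual_of_netSplit (atomicNetLaw_of_gapOrderLaw hO) hR

/-- … and `TopPinning`. -/
theorem topPinning_of_gapOrderSplit (hO : AtomicGapOrderLawQ) (hR : NonAtomicTopResidualQ) : TopPinning :=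
  topPinning_of_nonNestedAscResidual (topPinningResidual_of_gapOrderSplit hO hR)

end RhW08.Lens1ArcSign
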